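import Mathlib
import Literature.NumberTheory.LFunctions.Zhang2022.Section3Lemma33
import Literature.NumberTheory.LFunctions.Zhang2022.Section3Lemma36
import Literature.NumberTheory.LFunctions.Zhang2022.Section14MeanSquareMajorant
import HarnessLib

/-!
# Zhang (2022) §3, Lemma 3.4: the skeleton leaf `Lemma34` DISCHARGED (the exceptional set of (3.4))

Topic `Literature/NumberTheory/LFunctions/Zhang2022` (Landau–Siegel adjudication tree; verdict-neutral;
cell siegel-zhang, DAG node `Z22:Lem3.4`, cone leaf C01 of `Skeleton.theorem1_of_leaves`).
Y. Zhang, *Discrete mean estimates and the Landau–Siegel zero*, arXiv:2211.02515v1 (2022)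
[Zhang2022LandauSiegel] — **an unrefereed manuscript under adjudication; nothing here bears on its
Theorems 1–2 or on Landau–Siegel zeros.** §3, PDF p. 15, tex L796–L824:

> By (3.1) we may write `F(s,ψ)²⁰ = Σ_{n≤D⁸⁰} ν₂₀(n)ψ(n)n^{−s}`, `G(s,ψ)²⁰ = Σ_{n≤D⁸⁰} υ₂₀(n)ψ(n)n^{−s}`
> with `|ν₂₀(n)| ≤ τ₄₀(n)`, `|υ₂₀(n)| ≤ τ₄₀(n)`. Write `X₁(x,ψ) = Σ_{n≤x} ν₂₀(n)ψ(n)n^{−s₀}`,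
> `X₂(x,ψ) = Σ_{n≤x} υ₂₀(n)ψ(n)n^{−s₀}`. By Cauchy's inequality and the first assertion of Lemma 3.3
> we obtain `Σ_{ψ∈Ψ} (|X₁(D⁸⁰,ψ)| + |X₂(D⁸⁰,ψ)| + ∫₁^{D⁸⁰} (|X₁(x,ψ)| + |X₂(x,ψ)|) dx/x)² ≪ 𝔓𝓛¹⁶⁰²`.
> Thus we conclude **Lemma 3.4.** The inequality
> `|X₁(D⁸⁰,ψ)| + |X₂(D⁸⁰,ψ)| + ∫₁^{D⁸⁰} (|X₁(x,ψ)| + |X₂(x,ψ)|) dx/x < 𝓛¹¹⁷¹`  (3.4)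
> holds for all but at most `O(𝔓𝓛⁻⁷⁴⁰)` characters `ψ` in `Ψ`.

(`𝓛 = log D`, `P = exp 𝓛⁹`, `s₀ = ½ + 2πit₀`, `Ψ` = the primitive characters to the prime moduli
`p ∼ P`, `𝔓 = Σ_{p∼P} p`; Lemma 3.4 involves no Assumption (A).) The skeleton states it as the CLAIM
node `Skeleton.Lemma34` (`SkeletonPartOne.lean`; objects `nu20`, `ups20`, `X1`, `X2`, `Ineq34` of
`SkeletonObjects.lean`). This file PROVES `Skeleton.lemma34_holds : Skeleton.Lemma34` from tree
ingredients only (no new definition, no named fact), in the manuscript's four steps: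

1. `Lemma34.moment_one_le` / `moment_pair_le` [folklore] — the displayed second moment in general
   form: `Σ_{p∈M} Σ*_{ψ mod p} (‖S_a(B)‖ + ‖S_b(B)‖ + ∫₁^B (‖S_a(⌊x⌋)‖ + ‖S_b(⌊x⌋)‖) dx/x)²
   ≤ 4(1 + log²B)(Σ_{p∈M} p)(Σ_{n≤B}‖a(n)‖²n^{−2σ} + Σ_{n≤B}‖b(n)‖²n^{−2σ})` for moduli `> B`
   (`S_a(N,ψ) = Σ_{n≤N} a(n)ψ(n)n^{−s}` = `Lemma36.twist36 a 0 s ψ N`; the computation of the tree's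
   `Lemma36.moment36_le` with the integral from `1`: Lemma 3.3 (i) via `Lemma36.twist36_meanSquare_le`,
   Cauchy–Schwarz in `dx/x` via `Lemma36.sq_integral_div_le_log_mul_integral`).
2. `Lemma34.norm_nu20_le`, `norm_ups20_le` — "`|ν₂₀| ≤ τ₄₀`, `|υ₂₀| ≤ τ₄₀`": `|ν|, |υ| ≤ τ₂` ((3.1);
   `norm_divisorSumChar_le`, `|μ ∗ μχ| ≤ 1 ∗ 1`), and divisor majorants multiply under convolution
   (`MeanSquareMajorant.norm_seqConv_le_tau`, twenty times).
3. `Lemma34.coeff_moment_le` — "`≪ 𝓛¹⁶⁰⁰`" (`40² = 1600`, sharp): `MeanSquareMajorant.sum_tau_sq_div_le 40`.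
4. `Skeleton.lemma34_holds` — Chebyshev over `Ψ` (`Lemma36.sum_card_filter_le_of_moment36`,
   `Skeleton.finsum_chr_eq`) at the threshold `𝓛¹¹⁷¹`: with `B = D⁸⁰`, `log B = 80𝓛` and
   `K = majorantConst 1600 80 · 80¹⁶⁰⁰` the moment is `≤ 8·6401·K·𝔓·𝓛¹⁶⁰²` (`1 + 6400𝓛² ≤ 6401𝓛²`),
   so at most `C·𝔓·𝓛^{1602−2·1171} = C·𝔓·𝓛⁻⁷⁴⁰` members of `Ψ` violate (3.4), `C = 51208·K`, for
   every `D ≥ ⌈e²⌉` (then `𝓛 ≥ 2` and `D⁸⁰ ≤ P < p`) — the printed exponent `−740` exactly. Numbers,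
   not adjectives: `C` is absurd and unoptimised; only `740` matters downstream (`prop21_of_lemmas`).

## References

* Y. Zhang, arXiv:2211.02515v1 (2022), §3 Lemma 3.4 and the two paragraphs before it, p. 15;
  Lemma 3.3 (i) p. 14; (2.1), (2.6), (2.8), (2.9). [cite: Zhang2022LandauSiegel, §3 Lemma 3.4 p. 15]
-/

noncomputable section

open Finset MeasureTheory

namespace Literature.NumberTheory.LFunctions.Zhang2022

namespace Lemma34

open Lemma36 MeanSquareMajorant

/-! ### Layer 1: the second moment of `‖S(B)‖ + ∫₁^B ‖S(x)‖ dx/x` over primitive characters -/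

open scoped Classical in
/-- **The display before Lemma 3.4, one sequence** [folklore]: for `B ≥ 1`, moduli `> B` and any `a`,
`s`: `Σ_{p∈M} Σ*_{ψ mod p} (‖S(B,ψ)‖ + ∫₁^B ‖S(⌊x⌋,ψ)‖ dx/x)² ≤ (2 + 2log²B)(Σ_{p∈M} p) Σ_{n≤B} ‖a(n)‖²n^{−2 Re s}`
(`(u+v)² ≤ 2u² + 2v²`, orthogonality at height `B`, Cauchy–Schwarz in `dx/x` and orthogonality at
every height `⌊x⌋ ≤ B` under the integral). [cite: Zhang2022LandauSiegel, §3 Lemma 3.4 p. 15] -/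
theorem moment_one_le (a : ℕ → ℂ) (s : ℂ) {B : ℕ} (hB : 1 ≤ B) (M : Finset ℕ)
    (hM : ∀ p ∈ M, B < p) :
    ∑ p ∈ M, ∑ ψ : DirichletCharacter ℂ p with ψ.IsPrimitive,
        (‖twist36 a 0 s ψ B‖ + ∫ x in (1 : ℝ)..B, ‖twist36 a 0 s ψ ⌊x⌋₊‖ / x) ^ 2 ≤
      (2 + 2 * Real.log B ^ 2) * (∑ p ∈ M, (p : ℝ)) *
        ∑ n ∈ Ioc 0 B, ‖a n‖ ^ 2 * (n : ℝ) ^ (-(2 * s.re)) := by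
  set 𝔓 : ℝ := ∑ p ∈ M, (p : ℝ)
  set W : ℝ := ∑ n ∈ Ioc 0 B, ‖a n‖ ^ 2 * (n : ℝ) ^ (-(2 * s.re))
  set L : ℝ := Real.log B
  have ha : (0 : ℝ) < 1 := one_pos
  have hab : (1 : ℝ) ≤ B := Nat.one_le_cast.mpr hB
  have h𝔓 : 0 ≤ 𝔓 := sum_nonneg fun p _ => Nat.cast_nonneg p
  have hL0 : 0 ≤ L := Real.log_nonneg hab
  have hLint : IntervalIntegrable (fun x : ℝ => x⁻¹) volume 1 B := by
    refine intervalIntegral.intervalIntegrable_inv (fun x hx => ?_) continuousOn_id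
    rw [Set.uIcc_of_le hab] at hx
    exact (ha.trans_le hx.1).ne'
  -- (i) orthogonality (Lemma 3.3 (i)) at every height `N ≤ B`
  have horth : ∀ N, N ≤ B →
      ∑ p ∈ M, ∑ ψ : DirichletCharacter ℂ p with ψ.IsPrimitive, ‖twist36 a 0 s ψ N‖ ^ 2 ≤
        𝔓 * W := fun N hN =>
    (twist36_meanSquare_le a 0 s N M fun p hp => lt_of_le_of_lt hN (hM p hp)).trans
      (mul_le_mul_of_nonneg_left (sum_le_sum_of_subset_of_nonneg (Ioc_subset_Ioc le_rfl hN)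
        fun n _ _ => mul_nonneg (sq_nonneg _) (Real.rpow_nonneg (Nat.cast_nonneg n) _)) h𝔓)
  -- (ii) Cauchy–Schwarz per character
  have hCS : ∀ (p : ℕ) (ψ : DirichletCharacter ℂ p),
      (∫ x in (1 : ℝ)..B, ‖twist36 a 0 s ψ ⌊x⌋₊‖ / x) ^ 2 ≤
        L * ∫ x in (1 : ℝ)..B, ‖twist36 a 0 s ψ ⌊x⌋₊‖ ^ 2 / x := fun p ψ => by
    have h := sq_integral_div_le_log_mul_integral (fun x => ‖twist36 a 0 s ψ ⌊x⌋₊‖) ha hab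
      (intervalIntegrable_natFloor_div (fun N => ‖twist36 a 0 s ψ N‖) ha hab)
      (intervalIntegrable_natFloor_div (fun N => ‖twist36 a 0 s ψ N‖ ^ 2) ha hab)
    rwa [div_one] at h
  -- (iii) the integrated mean square: swap the finite sums with the integral, bound pointwise
  have hint : ∑ p ∈ M, ∑ ψ : DirichletCharacter ℂ p with ψ.IsPrimitive,
      ∫ x in (1 : ℝ)..B, ‖twist36 a 0 s ψ ⌊x⌋₊‖ ^ 2 / x ≤ 𝔓 * W * L := by
    have hinner : ∀ p ∈ M, ∑ ψ : DirichletCharacter ℂ p with ψ.IsPrimitive,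
        ∫ x in (1 : ℝ)..B, ‖twist36 a 0 s ψ ⌊x⌋₊‖ ^ 2 / x =
          ∫ x in (1 : ℝ)..B, (∑ ψ : DirichletCharacter ℂ p with ψ.IsPrimitive,
            ‖twist36 a 0 s ψ ⌊x⌋₊‖ ^ 2) / x := fun p _ => by
      rw [← intervalIntegral.integral_finsetSum fun ψ _ =>
        intervalIntegrable_natFloor_div (fun N => ‖twist36 a 0 s ψ N‖ ^ 2) ha hab]
      simp only [sum_div]
    rw [sum_congr rfl hinner, ← intervalIntegral.integral_finsetSum fun p _ =>
      intervalIntegrable_natFloor_div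
        (fun N => ∑ ψ : DirichletCharacter ℂ p with ψ.IsPrimitive, ‖twist36 a 0 s ψ N‖ ^ 2) ha hab]
    simp only [← sum_div]
    calc ∫ x in (1 : ℝ)..B, (∑ p ∈ M, ∑ ψ : DirichletCharacter ℂ p with ψ.IsPrimitive,
          ‖twist36 a 0 s ψ ⌊x⌋₊‖ ^ 2) / x
        ≤ ∫ x in (1 : ℝ)..B, 𝔓 * W * x⁻¹ := by
          refine intervalIntegral.integral_mono_on hab (intervalIntegrable_natFloor_div
            (fun N => ∑ p ∈ M, ∑ ψ : DirichletCharacter ℂ p with ψ.IsPrimitive,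
              ‖twist36 a 0 s ψ N‖ ^ 2) ha hab) (hLint.const_mul _) fun x hx => ?_
          rw [div_eq_mul_inv]
          exact mul_le_mul_of_nonneg_right (horth _ (Nat.floor_le_of_le hx.2))
            (inv_nonneg.mpr (ha.trans_le hx.1).le)
      _ = 𝔓 * W * L := by
          rw [intervalIntegral.integral_const_mul, integral_inv_of_pos ha (ha.trans_le hab), div_one]
  -- assembly
  calc ∑ p ∈ M, ∑ ψ : DirichletCharacter ℂ p with ψ.IsPrimitive,
        (‖twist36 a 0 s ψ B‖ + ∫ x in (1 : ℝ)..B, ‖twist36 a 0 s ψ ⌊x⌋₊‖ / x) ^ 2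
      ≤ ∑ p ∈ M, ∑ ψ : DirichletCharacter ℂ p with ψ.IsPrimitive,
          (2 * ‖twist36 a 0 s ψ B‖ ^ 2 +
            2 * L * ∫ x in (1 : ℝ)..B, ‖twist36 a 0 s ψ ⌊x⌋₊‖ ^ 2 / x) := by
        refine sum_le_sum fun p _ => sum_le_sum fun ψ _ => ?_
        nlinarith [hCS p ψ, sq_nonneg (‖twist36 a 0 s ψ B‖ -
          ∫ x in (1 : ℝ)..B, ‖twist36 a 0 s ψ ⌊x⌋₊‖ / x)]
    _ = 2 * (∑ p ∈ M, ∑ ψ : DirichletCharacter ℂ p with ψ.IsPrimitive, ‖twist36 a 0 s ψ B‖ ^ 2) +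
          2 * L * ∑ p ∈ M, ∑ ψ : DirichletCharacter ℂ p with ψ.IsPrimitive,
            ∫ x in (1 : ℝ)..B, ‖twist36 a 0 s ψ ⌊x⌋₊‖ ^ 2 / x := by
        simp only [sum_add_distrib, mul_sum]
    _ ≤ 2 * (𝔓 * W) + 2 * L * (𝔓 * W * L) :=
        add_le_add (mul_le_mul_of_nonneg_left (horth B le_rfl) zero_le_two)
          (mul_le_mul_of_nonneg_left hint (mul_nonneg zero_le_two hL0))
    _ = (2 + 2 * L ^ 2) * 𝔓 * W := by ring

open scoped Classical in
/-- **The display before Lemma 3.4** in the manuscript's two-sequence shape (`X₁` and `X₂` together):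
for `B ≥ 1`, moduli `> B`, any `a`, `b`, `s`,
`Σ_{p∈M} Σ*_{ψ mod p} (‖S_a(B)‖ + ‖S_b(B)‖ + ∫₁^B (‖S_a(⌊x⌋)‖ + ‖S_b(⌊x⌋)‖) dx/x)²
  ≤ 4(1 + log²B)(Σ_{p∈M} p)(Σ_{n≤B} ‖a(n)‖²n^{−2 Re s} + Σ_{n≤B} ‖b(n)‖²n^{−2 Re s})`.
[cite: Zhang2022LandauSiegel, §3 Lemma 3.4 p. 15] -/
theorem moment_pair_le (a b : ℕ → ℂ) (s : ℂ) {B : ℕ} (hB : 1 ≤ B) (M : Finset ℕ)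
    (hM : ∀ p ∈ M, B < p) :
    ∑ p ∈ M, ∑ ψ : DirichletCharacter ℂ p with ψ.IsPrimitive,
        (‖twist36 a 0 s ψ B‖ + ‖twist36 b 0 s ψ B‖ +
          ∫ x in (1 : ℝ)..B, (‖twist36 a 0 s ψ ⌊x⌋₊‖ + ‖twist36 b 0 s ψ ⌊x⌋₊‖) / x) ^ 2 ≤
      4 * (1 + Real.log B ^ 2) * (∑ p ∈ M, (p : ℝ)) *
        (∑ n ∈ Ioc 0 B, ‖a n‖ ^ 2 * (n : ℝ) ^ (-(2 * s.re)) +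
          ∑ n ∈ Ioc 0 B, ‖b n‖ ^ 2 * (n : ℝ) ^ (-(2 * s.re))) := by
  have hab : (1 : ℝ) ≤ B := Nat.one_le_cast.mpr hB
  -- abbreviate the one-sequence quantities `u_ψ`, `v_ψ`
  set u : (p : ℕ) → DirichletCharacter ℂ p → ℝ := fun p ψ =>
    ‖twist36 a 0 s ψ B‖ + ∫ x in (1 : ℝ)..B, ‖twist36 a 0 s ψ ⌊x⌋₊‖ / x with hu
  set v : (p : ℕ) → DirichletCharacter ℂ p → ℝ := fun p ψ =>
    ‖twist36 b 0 s ψ B‖ + ∫ x in (1 : ℝ)..B, ‖twist36 b 0 s ψ ⌊x⌋₊‖ / x with hv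
  have hsplit : ∀ (p : ℕ) (ψ : DirichletCharacter ℂ p),
      ‖twist36 a 0 s ψ B‖ + ‖twist36 b 0 s ψ B‖ +
        ∫ x in (1 : ℝ)..B, (‖twist36 a 0 s ψ ⌊x⌋₊‖ + ‖twist36 b 0 s ψ ⌊x⌋₊‖) / x = u p ψ + v p ψ := by
    intro p ψ
    simp only [hu, hv, add_div]
    rw [intervalIntegral.integral_add
      (intervalIntegrable_natFloor_div (fun N => ‖twist36 a 0 s ψ N‖) one_pos hab)
      (intervalIntegrable_natFloor_div (fun N => ‖twist36 b 0 s ψ N‖) one_pos hab)]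
    ring
  have hA : ∑ p ∈ M, ∑ ψ : DirichletCharacter ℂ p with ψ.IsPrimitive, u p ψ ^ 2 ≤
      (2 + 2 * Real.log B ^ 2) * (∑ p ∈ M, (p : ℝ)) *
        ∑ n ∈ Ioc 0 B, ‖a n‖ ^ 2 * (n : ℝ) ^ (-(2 * s.re)) := moment_one_le a s hB M hM
  have hB' : ∑ p ∈ M, ∑ ψ : DirichletCharacter ℂ p with ψ.IsPrimitive, v p ψ ^ 2 ≤
      (2 + 2 * Real.log B ^ 2) * (∑ p ∈ M, (p : ℝ)) *
        ∑ n ∈ Ioc 0 B, ‖b n‖ ^ 2 * (n : ℝ) ^ (-(2 * s.re)) := moment_one_le b s hB M hM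
  calc ∑ p ∈ M, ∑ ψ : DirichletCharacter ℂ p with ψ.IsPrimitive,
        (‖twist36 a 0 s ψ B‖ + ‖twist36 b 0 s ψ B‖ +
          ∫ x in (1 : ℝ)..B, (‖twist36 a 0 s ψ ⌊x⌋₊‖ + ‖twist36 b 0 s ψ ⌊x⌋₊‖) / x) ^ 2
      ≤ ∑ p ∈ M, ∑ ψ : DirichletCharacter ℂ p with ψ.IsPrimitive,
          (2 * u p ψ ^ 2 + 2 * v p ψ ^ 2) := by
        refine sum_le_sum fun p _ => sum_le_sum fun ψ _ => ?_
        rw [hsplit p ψ]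
        nlinarith [sq_nonneg (u p ψ - v p ψ)]
    _ = 2 * (∑ p ∈ M, ∑ ψ : DirichletCharacter ℂ p with ψ.IsPrimitive, u p ψ ^ 2) +
          2 * ∑ p ∈ M, ∑ ψ : DirichletCharacter ℂ p with ψ.IsPrimitive, v p ψ ^ 2 := by
        simp only [sum_add_distrib, mul_sum]
    _ ≤ 2 * ((2 + 2 * Real.log B ^ 2) * (∑ p ∈ M, (p : ℝ)) *
            ∑ n ∈ Ioc 0 B, ‖a n‖ ^ 2 * (n : ℝ) ^ (-(2 * s.re))) +
          2 * ((2 + 2 * Real.log B ^ 2) * (∑ p ∈ M, (p : ℝ)) *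
            ∑ n ∈ Ioc 0 B, ‖b n‖ ^ 2 * (n : ℝ) ^ (-(2 * s.re))) :=
        add_le_add (mul_le_mul_of_nonneg_left hA zero_le_two)
          (mul_le_mul_of_nonneg_left hB' zero_le_two)
    _ = _ := by ring

/-! ### Layer 2: `|ν₂₀| ≤ τ₄₀`, `|υ₂₀| ≤ τ₄₀`, and `Σ_{n≤X} τ₄₀(n)²/n ≪ (log X)¹⁶⁰⁰` -/

/-- Truncation does not increase absolute values. [folklore] -/
private theorem norm_trunc_le (N : ℕ) (a : ℕ → ℂ) (n : ℕ) : ‖Skeleton.trunc N a n‖ ≤ ‖a n‖ := by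
  unfold Skeleton.trunc; split_ifs <;> simp

/-- **Divisor majorants under iterated convolution**: if `‖a(n)‖ ≤ τ₂(n)` for `n ≥ 1`, then
`‖a^{∗k}(n)‖ ≤ τ_{2k}(n)` (`MeanSquareMajorant.norm_seqConv_le_tau`, `k` times).
[cite: Zhang2022LandauSiegel, §3 p. 15] -/
theorem norm_convPow_le {a : ℕ → ℂ} (ha : ∀ n, n ≠ 0 → ‖a n‖ ≤ tau 2 n) :
    ∀ k n : ℕ, ‖Skeleton.convPow a k n‖ ≤ tau (2 * k) n := by
  intro k
  induction k with
  | zero =>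
    intro n
    simp only [Skeleton.convPow, mul_zero, tau_zero, ArithmeticFunction.one_apply]
    split_ifs <;> simp
  | succ k ih =>
    intro n
    have hconv : Skeleton.convPow a (k + 1) n = seqConv a (Skeleton.convPow a k) n := by
      simp only [Skeleton.convPow, LSeries.convolution_def, seqConv]
    rw [hconv, show 2 * (k + 1) = 2 + 2 * k by ring]
    simpa only [one_mul] using norm_seqConv_le_tau (u := a) (v := Skeleton.convPow a k)
      (C₁ := 1) (C₂ := 1) (j₁ := 2) (j₂ := 2 * k) zero_le_one
      (fun n hn => by rw [one_mul]; exact ha n hn) (fun n _ => by rw [one_mul]; exact ih n) n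

variable {D : ℕ} (χ : DirichletCharacter ℂ D)

/-- **(3.1), `ν ≤ τ₂`**: `‖ν(n)‖ = ‖Σ_{d∣n} χ(d)‖ ≤ τ₂(n)` (`norm_divisorSumChar_le`).
[cite: Zhang2022LandauSiegel, §3 (3.1)] -/
theorem norm_nu_le (n : ℕ) : ‖Skeleton.nu χ n‖ ≤ tau 2 n := by
  rw [tau_two_apply]; exact norm_divisorSumChar_le χ n

/-- **(3.1), `|υ| ≤ τ₂`**: `‖υ(n)‖ = ‖Σ_{n=de} μ(d)μ(e)χ(e)‖ ≤ τ₂(n)` (two sequences bounded by `1`;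
`MeanSquareMajorant.norm_seqConv_le_tau_two`). [cite: Zhang2022LandauSiegel, §3 (3.1)] -/
theorem norm_ups_le (n : ℕ) : ‖Skeleton.ups χ n‖ ≤ tau 2 n := by
  have h : Skeleton.ups χ n = seqConv (fun m => (ArithmeticFunction.moebius m : ℂ))
      (fun m => (ArithmeticFunction.moebius m : ℂ) * χ (m : ZMod D)) n := by
    simp only [Skeleton.ups, LSeries.convolution_def, seqConv]
  have hμ : ∀ m : ℕ, ‖(ArithmeticFunction.moebius m : ℂ)‖ ≤ 1 := fun m => by
    rw [Complex.norm_intCast]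
    exact_mod_cast ArithmeticFunction.abs_moebius_le_one
  rw [h]
  simpa only [one_mul] using norm_seqConv_le_tau_two
    (u := fun m => (ArithmeticFunction.moebius m : ℂ))
    (v := fun m => (ArithmeticFunction.moebius m : ℂ) * χ (m : ZMod D)) (C₁ := 1) (C₂ := 1)
    zero_le_one (fun m _ => hμ m) (fun m _ => by
      rw [norm_mul]; exact mul_le_one₀ (hμ m) (norm_nonneg _) (DirichletCharacter.norm_le_one χ _)) n

/-- **"`|ν₂₀(n)| ≤ τ₄₀(n)`"** (the 20-fold convolution power of `ν·1_{n≤D⁴}`).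
[cite: Zhang2022LandauSiegel, §3 p. 15] -/
theorem norm_nu20_le (n : ℕ) : ‖Skeleton.nu20 χ n‖ ≤ tau 40 n :=
  norm_convPow_le (a := Skeleton.trunc (D ^ 4) (Skeleton.nu χ))
    (fun m _ => (norm_trunc_le _ _ m).trans (norm_nu_le χ m)) 20 n

/-- **"`|υ₂₀(n)| ≤ τ₄₀(n)`"** (the 20-fold convolution power of `υ·1_{n≤D⁴}`).
[cite: Zhang2022LandauSiegel, §3 p. 15] -/
theorem norm_ups20_le (n : ℕ) : ‖Skeleton.ups20 χ n‖ ≤ tau 40 n :=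
  norm_convPow_le (a := Skeleton.trunc (D ^ 4) (Skeleton.ups χ))
    (fun m _ => (norm_trunc_le _ _ m).trans (norm_ups_le χ m)) 20 n

/-- **The coefficient moment "`≪ 𝓛¹⁶⁰⁰`"**: if `‖a(n)‖ ≤ τ₄₀(n)` for all `n`, then for `X ≥ 2`,
`Σ_{n≤X} ‖a(n)‖² n^{−2·½} ≤ majorantConst 1600 80 · (log X)¹⁶⁰⁰` (`MeanSquareMajorant.sum_tau_sq_div_le
40`; the exponent `40² = 1600` is sharp). [cite: Zhang2022LandauSiegel, §3 p. 15] -/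
theorem coeff_moment_le {a : ℕ → ℂ} (ha : ∀ n, ‖a n‖ ≤ tau 40 n) {X : ℕ} (hX : 2 ≤ X) :
    ∑ n ∈ Ioc 0 X, ‖a n‖ ^ 2 * (n : ℝ) ^ (-(2 * (1 / 2 : ℝ))) ≤
      majorantConst 1600 80 * Real.log X ^ 1600 := by
  have key := sum_tau_sq_div_le 40 hX
  norm_num at key
  have hIcc : Icc 1 X = Ioc 0 X := by
    ext n; simp only [mem_Icc, mem_Ioc]; omega
  calc ∑ n ∈ Ioc 0 X, ‖a n‖ ^ 2 * (n : ℝ) ^ (-(2 * (1 / 2 : ℝ)))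
      = ∑ n ∈ Icc 1 X, ‖a n‖ ^ 2 / n := by
        rw [hIcc]
        refine sum_congr rfl fun n _ => ?_
        rw [show -(2 * (1 / 2 : ℝ)) = -1 by norm_num, Real.rpow_neg_one, div_eq_mul_inv]
    _ ≤ ∑ n ∈ Icc 1 X, tau 40 n ^ 2 / n := sum_le_sum fun n _ =>
        div_le_div_of_nonneg_right (pow_le_pow_left₀ (norm_nonneg _) (ha n) 2) (Nat.cast_nonneg n)
    _ ≤ majorantConst 1600 80 * Real.log X ^ 1600 := key

end Lemma34

/-! ### Layer 3: Lemma 3.4 for the skeleton's objects -/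

namespace Skeleton

open Lemma34 Lemma36 MeanSquareMajorant

open scoped Classical in
/-- **`#{ψ ∈ Ψ : Q(ψ)} = Σ_{p∼P} #{ψ (mod p) primitive : Q(ψ)}`** (from `Skeleton.finsum_chr_eq`): the
count of an exceptional subfamily of `Ψ`, modulus by modulus, as the tree's Chebyshev step
`Lemma36.sum_card_filter_le_of_moment36` bounds it. [cite: Zhang2022LandauSiegel, §3 p. 15] -/
theorem ncard_chr_eq (D : ℕ) (Q : (p : ℕ) → DirichletCharacter ℂ p → Prop) :
    ({x : Chr D | Q x.p x.ψ}.ncard : ℝ) =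
      ∑ p ∈ primeWindow D,
        (((univ : Finset (DirichletCharacter ℂ p)).filter fun ψ => ψ.IsPrimitive ∧ Q p ψ).card : ℝ) := by
  haveI : Fintype (Chr D) := Fintype.ofFinite _
  rw [Set.ncard_eq_toFinset_card', Set.toFinset_setOf, Finset.card_filter, Nat.cast_sum,
    ← finsum_eq_sum_of_fintype, finsum_chr_eq D (fun p ψ => ((if Q p ψ then 1 else 0 : ℕ) : ℝ))]
  refine sum_congr rfl fun p _ => ?_
  rw [← filter_filter, Finset.card_filter, Nat.cast_sum]

/-- `X₁(y,ψ)`, `X₂(y,ψ)` are the twisted partial sums of `ν₂₀`, `υ₂₀` at height `⌊y⌋`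
(`{1 ≤ n ≤ N} = {0 < n ≤ N}`). [cite: Zhang2022LandauSiegel, §3 p. 15] -/
private theorem X1_eq_and_X2_eq {D : ℕ} [NeZero D] (χ : DirichletCharacter ℂ D) (x : Chr D)
    (y : ℝ) : X1 χ x y = twist36 (nu20 χ) 0 (s0 D) x.ψ ⌊y⌋₊ ∧
      X2 χ x y = twist36 (ups20 χ) 0 (s0 D) x.ψ ⌊y⌋₊ := by
  have h : Icc 1 ⌊y⌋₊ = Ioc 0 ⌊y⌋₊ := by ext n; simp only [mem_Icc, mem_Ioc]; omega
  exact ⟨by rw [X1, twist36, h], by rw [X2, twist36, h]⟩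

/-- `log D ≥ 2` and `D ≥ 3` once `D ≥ ⌈e²⌉`. [folklore] -/
private theorem two_le_ell {D : ℕ} (hD : ⌈Real.exp 2⌉₊ ≤ D) : 2 ≤ ell D ∧ 3 ≤ D := by
  have h : Real.exp 2 ≤ D := le_trans (Nat.le_ceil _) (by exact_mod_cast hD)
  have h3 : (3 : ℝ) ≤ Real.exp 2 := by linarith [Real.add_one_le_exp (2 : ℝ)]
  exact ⟨(Real.le_log_iff_exp_le (lt_of_lt_of_le (Real.exp_pos _) h)).mpr h,
    by exact_mod_cast h3.trans h⟩

/-- For `𝓛 ≥ 2`: `D⁸⁰ = exp(80𝓛) ≤ exp 𝓛⁹ = P` (`80𝓛 ≤ 2⁸𝓛 ≤ 𝓛⁹`), so every modulus `p ∼ P` of the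
window exceeds `D⁸⁰`. [cite: Zhang2022LandauSiegel, §2 (2.6)] -/
private theorem pow_eighty_lt_of_mem {D p : ℕ} (hℓ : 2 ≤ ell D) (hD : 0 < D)
    (hp : p ∈ primeWindow D) : D ^ 80 < p := by
  have hwin : ⌊bigP D⌋₊ < p := by
    simp only [primeWindow, Finset.mem_filter, Finset.mem_Ioo] at hp
    exact hp.1.1
  refine lt_of_le_of_lt (Nat.le_floor ?_) hwin
  have hD' : (0 : ℝ) < D := Nat.cast_pos.mpr hD
  rw [Nat.cast_pow, ← Real.exp_log (pow_pos hD' 80), Real.log_pow, Nat.cast_ofNat, bigP]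
  apply Real.exp_le_exp.mpr
  have h8 : (2 : ℝ) ^ 8 ≤ ell D ^ 8 := pow_le_pow_left₀ (by norm_num) hℓ 8
  calc (80 : ℝ) * Real.log D = 80 * ell D := rfl
    _ ≤ 2 ^ 8 * ell D := by nlinarith
    _ ≤ ell D ^ 8 * ell D := mul_le_mul_of_nonneg_right h8 (by linarith)
    _ = ell D ^ 9 := by ring

open scoped Classical in
/-- **Lemma 3.4 HOLDS** (the node `Skeleton.Lemma34`, cone leaf C01 of `theorem1_of_leaves`): with the
absolute constant `C = 51208 · majorantConst 1600 80 · 80¹⁶⁰⁰`, for every `D ≥ ⌈e²⌉` and every real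
primitive `χ (mod D)`, the inequality (3.4) fails for at most `C·𝔓·𝓛⁻⁷⁴⁰` characters `ψ ∈ Ψ` — by the
second-moment bound `Σ_{ψ∈Ψ}(…)² ≤ 8·6401·K·𝔓·𝓛¹⁶⁰²` (Lemma 3.3 (i) + Cauchy–Schwarz + `|ν₂₀|,|υ₂₀| ≤ τ₄₀`
+ `Σ_{n≤D⁸⁰} τ₄₀(n)²/n ≪ 𝓛¹⁶⁰⁰`) and Chebyshev at the threshold `𝓛¹¹⁷¹` (`1602 − 2·1171 = −740`).
No Assumption (A), no named fact. [cite: Zhang2022LandauSiegel, §3 Lemma 3.4 p. 15] -/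
theorem lemma34_holds : Lemma34 := by
  obtain ⟨K, hKdef⟩ : ∃ K : ℝ, K = majorantConst 1600 80 * (80 : ℝ) ^ 1600 := ⟨_, rfl⟩
  have hK0 : 0 < K := hKdef ▸ mul_pos (majorantConst_pos _ _) (pow_pos (by norm_num) _)
  refine ⟨8 * 6401 * K, ⌈Real.exp 2⌉₊, fun D _ χ hD _hq _hp => ?_⟩
  dsimp only
  obtain ⟨hl2, hD3⟩ := two_le_ell hD
  have hD0 : 0 < D := by omega
  have hl0 : 0 < ell D := by linarith
  set B : ℕ := D ^ 80 with hBdef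
  have hB1 : 1 ≤ B := Nat.one_le_pow _ _ hD0
  have hB2 : 2 ≤ B := le_trans (by omega : 2 ≤ D) (Nat.le_self_pow (by norm_num) D)
  have hBreal : ((B : ℕ) : ℝ) = (D : ℝ) ^ 80 := by rw [hBdef, Nat.cast_pow]
  have hfloor : ⌊(D : ℝ) ^ 80⌋₊ = B := by rw [← hBreal, Nat.floor_natCast]
  have hlogB : Real.log ((B : ℕ) : ℝ) = 80 * ell D := by
    rw [hBreal, Real.log_pow, Nat.cast_ofNat, ell]
  have hM : ∀ p ∈ primeWindow D, B < p := fun p hp => pow_eighty_lt_of_mem hl2 hD0 hp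
  -- the (3.4)-quantity as a function of `(p, ψ)`
  set Y : (p : ℕ) → DirichletCharacter ℂ p → ℝ := fun p ψ =>
    ‖twist36 (nu20 χ) 0 (s0 D) ψ B‖ + ‖twist36 (ups20 χ) 0 (s0 D) ψ B‖ +
      ∫ x in (1 : ℝ)..B, (‖twist36 (nu20 χ) 0 (s0 D) ψ ⌊x⌋₊‖ + ‖twist36 (ups20 χ) 0 (s0 D) ψ ⌊x⌋₊‖) / x
    with hYdef
  have hset : {x : Chr D | ¬ Ineq34 χ x} = {x : Chr D | ell D ^ 1171 ≤ Y x.p x.ψ} := by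
    ext x
    simp only [Set.mem_setOf_eq, Ineq34, not_lt, X1_eq_and_X2_eq, hfloor, hYdef, hBreal]
  -- the second moment over `Ψ` (`Re s₀ = 1/2`)
  have hs0 : (s0 D).re = 1 / 2 := by simp [s0, SmoothWeight.s0]
  have hmom := moment_pair_le (nu20 χ) (ups20 χ) (s0 D) hB1 (primeWindow D) hM
  rw [hs0, ← frakP_eq_sum_primeWindow] at hmom
  have hW1 := coeff_moment_le (norm_nu20_le χ) hB2
  have hW2 := coeff_moment_le (norm_ups20_le χ) hB2
  have hWK : majorantConst 1600 80 * Real.log ((B : ℕ) : ℝ) ^ 1600 = K * ell D ^ 1600 := by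
    rw [hlogB, mul_pow, hKdef, mul_assoc]
  rw [hWK] at hW1 hW2
  clear hKdef hWK
  have h𝔓 : 0 ≤ frakP D := frakP_eq_sum_primeWindow D ▸ sum_nonneg fun p _ => Nat.cast_nonneg p
  have hT : 4 * (1 + Real.log ((B : ℕ) : ℝ) ^ 2) * frakP D *
      (∑ n ∈ Ioc 0 B, ‖nu20 χ n‖ ^ 2 * (n : ℝ) ^ (-(2 * (1 / 2 : ℝ))) +
        ∑ n ∈ Ioc 0 B, ‖ups20 χ n‖ ^ 2 * (n : ℝ) ^ (-(2 * (1 / 2 : ℝ)))) ≤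
      8 * 6401 * K * frakP D * ell D ^ 1602 := by
    have h1 : 1 + (80 * ell D) ^ 2 ≤ 6401 * ell D ^ 2 := by nlinarith
    rw [hlogB]
    calc 4 * (1 + (80 * ell D) ^ 2) * frakP D *
          (∑ n ∈ Ioc 0 B, ‖nu20 χ n‖ ^ 2 * (n : ℝ) ^ (-(2 * (1 / 2 : ℝ))) +
            ∑ n ∈ Ioc 0 B, ‖ups20 χ n‖ ^ 2 * (n : ℝ) ^ (-(2 * (1 / 2 : ℝ))))
        ≤ 4 * (6401 * ell D ^ 2) * frakP D * (2 * (K * ell D ^ 1600)) := by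
          gcongr; linarith
      _ = 8 * 6401 * K * frakP D * ell D ^ 1602 := by ring
  -- Chebyshev at the threshold `𝓛¹¹⁷¹`
  have hcount := sum_card_filter_le_of_moment36 (primeWindow D) Y (pow_pos hl0 1171) (hmom.trans hT)
  rw [hset, ncard_chr_eq D (fun p ψ => ell D ^ 1171 ≤ Y p ψ)]
  refine hcount.trans_eq ?_
  rw [show (ell D ^ 1171) ^ 2 = ell D ^ 1602 * ell D ^ 740 by rw [← pow_mul, ← pow_add]]
  field_simp

end Skeleton

end Literature.NumberTheory.LFunctions.Zhang2022

end
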